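import Mathlib
import HarnessLib
import Summits.HubbardSuperconductivity.HubbardSuperconductivity.Theorems.KLProgrammeKLRegimeEngineTowerRemeasureSum
import Summits.HubbardSuperconductivity.HubbardSuperconductivity.Theorems.KLProgrammeKLRegimeEngineNormsJumpLastLegCountUniform
import Literature.NumberTheory.LFunctions.ZetaPartialSumZeroTotal

/-!
# Route `KLProgramme` — crux K3 ENGINE (stmt-HubbardSuperconductivity-20437 `KLRegimeEngineV17F2`), stub (b) v2, THE LEVELS PACKAGE (ℓ), instantiation (I2):
# THE LEVELLED RE-MEASUREMENT ROWS WITH m-UNIFORM CONSTANTS (located item «(I2)-CONST-UNIFORM»; cell gate-hubbard-kl, seat p4 g17)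

The kit `towerBorn_le_law_tracks` runs every degree `m` up to the volume-dependent cap, with `hμ`-coefficients of the form `c₁·c₂^m` and ONE set of regime
thresholds.  The levelled jump rows of `…EngineTowerRemeasureLev` (k3c2-p3) and the summed row of `…EngineTowerRemeasureSum` (p4) are typed `(m) : ∃ C, ∀ R,
∃ c₃′ U₀′, …` — constants and thresholds per degree — only because the count row they read was.  On the m-uniform count
`card_relCount_prescribed_lastLeg_klAniso_le_window_uniform` (p4 g17) the same proofs give the kit-ready forms:

* **`klLevNormOf_jump_le_klEng_uniform`** — `∃ C₁ C₂ > 0, ∀ R (WF2), ∃ c₃′ U₀′ > 0, ∀ m, …: klLevNormOf … J′ (m+1) T Ωe ≤ C₁·C₂^m·(2^{J′−k})^{m−F}·N`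
  (`C₁ = 324·CJ·(D₀+1)`, `C₂ = 162·CJ`; `(m+2)³ ≤ 8·4^m` is the tree's `cube_le_eight_mul_four_pow`);
* **`klLevNormOf_klTowerIncr_remeasure_le_klEng_uniform`**, **`klLevNormOf_scaleZero_remeasure_le_klEng_uniform`** — the tower instances, `∀ m` inside;
* **`klTowerMeasLev_le_uv_add_sum_bornLev_klEng_lastLeg_uniform`** — the summed levelled `hμ` row in absolute units with ONE constant `C₁·C₂^m` and m-free thresholds.
Compositions of landed theorems; nothing about the model is asserted beyond them; nothing asserts (ℓ), any stub, K3 or superconductivity.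
References: BGM 2006 §2.8 (2.76), (2.82)–(2.84), (2.88)–(2.90) [cite: BenfattoGiulianiMastropietro2006].
-/

noncomputable section

namespace Summit.HubbardSuperconductivity.HubbardSuperconductivity.Theorems.EngineV8

set_option linter.dupNamespace false -- summit = problem name (single-conjunct summit), D-0017

open Classical
open Real Finset Literature.MathematicalPhysics.QuantumLattice Literature.Probability.LatticeModels GrassmannAlgebra
open Literature.MathematicalPhysics.QuantumLattice.FermiRG
open Summit.HubbardSuperconductivity.HubbardSuperconductivity.Theorems.KLProgrammeLegKernels
open Summit.HubbardSuperconductivity.HubbardSuperconductivity.Theorems.KLRegimeSplit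
open Summit.HubbardSuperconductivity.HubbardSuperconductivity.Theorems.KLRegimeWick
open Summit.HubbardSuperconductivity.HubbardSuperconductivity.Theorems.TorusFourierL2
open Summit.HubbardSuperconductivity.HubbardSuperconductivity.Theorems.DispersionFlow
open Summit.HubbardSuperconductivity.HubbardSuperconductivity.Theorems.PerturbedFermiCurve

variable {L M : ℕ} [NeZero L] [NeZero M]

/-! ## §1 The levelled jump with m-uniform constants -/

omit [NeZero L] [NeZero M] in
/-- **THE LEVELLED JUMP UNDER THE STUB BINDERS, m-UNIFORM** (twin of `klLevNormOf_jump_le_klEng`): constants `C₁, C₂` and, for every `R`, thresholds `c₃′, U₀′` fixed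
BEFORE the number of legs; for every `m` and the binders of the original row,
`klLevNormOf … J′ (m+1) T Ωe ≤ C₁·C₂^m·(2^{J′−k})^{m − levelCount Ωe}·N`. [cite: BenfattoGiulianiMastropietro2006, §2.8 (2.82)-(2.84), (2.88)-(2.90)] -/
theorem klLevNormOf_jump_le_klEng_uniform :
    ∃ C₁ C₂ : ℝ, 0 < C₁ ∧ 0 < C₂ ∧ ∀ R : RenConsts, R.WF2 → ∃ c₃' : ℝ, 0 < c₃' ∧ ∃ U₀' : ℝ, 0 < U₀' ∧ ∀ m : ℕ,
      ∀ (P : SplitConsts) (c : ℝ), P.WF → 0 < c → c ≤ klEngC₃6 P R → c ≤ c₃' →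
      ∀ μ ∈ klWindowC, ∀ U : ℝ, 0 < U → U ≤ klEngU₀9 P R c → U ≤ U₀' → ∀ β : ℝ, klBetaMin ≤ β → β ≤ Real.exp (c / U ^ 2) →
      ∀ K : TrigPolyC4v, FrameOK R U (nScales β) μ K → ∀ (L M : ℕ) [NeZero L] [NeZero M],
      klEngL₃ β U ≤ L → klEngM₃ β U L ≤ M → ∀ k J' : ℕ, k + 1 ≤ J' → J' ≤ nScales β + 1 →
      ∀ T : HubbardGrassmann L M,
        (∀ (m' : ℕ) (X : Fin m' → HubbardFieldIdx L M), ∑ i, signedMomentum L (X i).2 (X i).1.1.2 ≠ 0 → kernel ℂ T m' X = 0) →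
      ∀ (Ωe : Fin (m + 1) → Option (SectorLeg (sectorCount J'))) (N : ℝ), 0 ≤ N →
        (∀ Ωe' : Fin (m + 1) → Option (SectorLeg (sectorCount k)), levelCount Ωe' = levelCount Ωe →
          klLevNormOf L M β μ K k (m + 1) T Ωe' ≤ N) →
        klLevNormOf L M β μ K J' (m + 1) T Ωe ≤ C₁ * C₂ ^ m * ((2 : ℝ) ^ (J' - k)) ^ (m - levelCount Ωe) * N := by
  obtain ⟨CJ, hCJ, hov⟩ := overlap_jump_sums_klEng
  obtain ⟨D₀, hD₀, hreg⟩ := card_relCount_prescribed_lastLeg_klAniso_le_window_uniform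
  refine ⟨324 * CJ * (D₀ + 1), 162 * CJ, by positivity, by positivity, fun R hR2 => ?_⟩
  have hRj : ∀ j, 0 ≤ R.Gfr j := gfr_nonneg_of_wf2 hR2
  obtain ⟨c₃, hc₃, U₀, hU₀, hcnt⟩ := hreg R hRj
  refine ⟨c₃, hc₃, U₀, hU₀, ?_⟩
  intro m P c hP hc hc6 hc₃' μ hμ U hU hU9 hU₀' β hβmin hβc K hK L M _ _ hL3 hM3 k J' hJ hJN T hT Ωe N hN0 hN
  have hβ : 0 < β := KLRegimeSplit.pos_of_klBetaMin_le hβmin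
  obtain ⟨_, hcol₁, hrow₁⟩ := hov P R c hP hR2 hc hc6 μ hμ U hU hU9 β hβmin hβc K hK L M hL3 hM3 k J' hJ hJN
  have hc₁0 : (0 : ℝ) ≤ 3 * CJ * M / β := by positivity
  have hD'0 : (0 : ℝ) ≤ (D₀ + 1) * ((m : ℝ) + 2) ^ 3 := by positivity
  have h := klLevNormOf_jump_le_of_consts hβ μ K hJ T hT hc₁0 hc₁0 hD'0 hcol₁ hrow₁ m
    (fun E τ'' σ' => hcnt m c hc hc₃' U hU hU₀' β hβmin hβc μ hμ μ K hK L M k J' (by omega) _ subset_rfl E τ'' σ') Ωe hN0 hN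
  have hMne : (M : ℝ) ≠ 0 := by exact_mod_cast NeZero.ne M
  have hεc : imagTimeWeight β M * (3 * CJ * M / β) = 3 * CJ / 2 := by
    unfold imagTimeWeight; field_simp
  have hconst : (3 * CJ * M / β) ^ m * (3 * CJ * M / β) * imagTimeWeight β M ^ (m + 1) = (3 * CJ / 2) ^ (m + 1) := by
    rw [← pow_succ, ← mul_pow, mul_comm (3 * CJ * M / β), hεc]
  have hX0 : (0 : ℝ) ≤ ((2 : ℝ) ^ (J' - k)) ^ (m - levelCount Ωe) * N := by positivity
  have hpoly : ((m : ℝ) + 2) ^ 3 ≤ 8 * 4 ^ m := Literature.NumberTheory.LFunctions.cube_le_eight_mul_four_pow m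
  have hD'le : (D₀ + 1) * ((m : ℝ) + 2) ^ 3 * 27 ^ (m + 1) ≤ (D₀ + 1) * (8 * 4 ^ m) * 27 ^ (m + 1) := by gcongr
  calc klLevNormOf L M β μ K J' (m + 1) T Ωe
      ≤ (3 * CJ * M / β) ^ m * (3 * CJ * M / β) * imagTimeWeight β M ^ (m + 1) * ((D₀ + 1) * ((m : ℝ) + 2) ^ 3 * 27 ^ (m + 1)) *
          ((2 : ℝ) ^ (J' - k)) ^ (m - levelCount Ωe) * N := h
    _ = (3 * CJ / 2) ^ (m + 1) * ((D₀ + 1) * ((m : ℝ) + 2) ^ 3 * 27 ^ (m + 1)) * (((2 : ℝ) ^ (J' - k)) ^ (m - levelCount Ωe) * N) := by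
        rw [hconst]; ring
    _ ≤ (3 * CJ / 2) ^ (m + 1) * ((D₀ + 1) * (8 * 4 ^ m) * 27 ^ (m + 1)) * (((2 : ℝ) ^ (J' - k)) ^ (m - levelCount Ωe) * N) := by
        gcongr
    _ = 324 * CJ * (D₀ + 1) * (162 * CJ) ^ m * ((2 : ℝ) ^ (J' - k)) ^ (m - levelCount Ωe) * N := by
        have h32 : (3 * CJ / 2 : ℝ) ^ (m + 1) = (3 / 2 : ℝ) ^ m * CJ ^ m * (3 * CJ / 2) := by
          rw [pow_succ, show (3 * CJ / 2 : ℝ) = 3 / 2 * CJ by ring, mul_pow]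
        have h27 : (27 : ℝ) ^ (m + 1) = 27 ^ m * 27 := pow_succ _ _
        have h162 : (162 * CJ : ℝ) ^ m = (3 / 2 : ℝ) ^ m * 4 ^ m * 27 ^ m * CJ ^ m := by
          rw [← mul_pow, ← mul_pow, ← mul_pow]; norm_num
        rw [h32, h27, h162]; ring

/-! ## §2 The tower instances, `∀ m` inside -/

omit [NeZero L] [NeZero M] in
/-- **THE INCREMENT `Δ_{k′}` RE-MEASURED AT `F_{dk−1}`, m-UNIFORM** (twin of `klLevNormOf_klTowerIncr_remeasure_le_klEng`).
[cite: BenfattoGiulianiMastropietro2006, §2.8 (2.82)-(2.84), (2.88)-(2.90)] -/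
theorem klLevNormOf_klTowerIncr_remeasure_le_klEng_uniform :
    ∃ C₁ C₂ : ℝ, 0 < C₁ ∧ 0 < C₂ ∧ ∀ R : RenConsts, R.WF2 → ∃ c₃' : ℝ, 0 < c₃' ∧ ∃ U₀' : ℝ, 0 < U₀' ∧ ∀ m : ℕ,
      ∀ (P : SplitConsts) (c : ℝ), P.WF → 0 < c → c ≤ klEngC₃6 P R → c ≤ c₃' →
      ∀ μ ∈ klWindowC, ∀ U : ℝ, 0 < U → U ≤ klEngU₀9 P R c → U ≤ U₀' → ∀ β : ℝ, klBetaMin ≤ β → β ≤ Real.exp (c / U ^ 2) →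
      ∀ K : TrigPolyC4v, FrameOK R U (nScales β) μ K → ∀ (L M : ℕ) [NeZero L] [NeZero M],
      klEngL₃ β U ≤ L → klEngM₃ β U L ≤ M → ∀ d k k' : ℕ, 2 ≤ d → k' < k → d * k - 1 ≤ nScales β + 1 →
      ∀ Ωe : Fin (m + 1) → Option (SectorLeg (sectorCount (d * k - 1))),
        klLevNormOf L M β μ K (d * k - 1) (m + 1) (klTowerIncr L M β U μ K d k') Ωe ≤
          C₁ * C₂ ^ m * ((2 : ℝ) ^ (d * k - 1 - d * k')) ^ (m - levelCount Ωe) * klTowerBornLev L M β U μ K d k' (m + 1) (levelCount Ωe) := by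
  obtain ⟨C₁, C₂, hC₁, hC₂, h⟩ := klLevNormOf_jump_le_klEng_uniform
  refine ⟨C₁, C₂, hC₁, hC₂, fun R hR2 => ?_⟩
  obtain ⟨c₃, hc₃, U₀, hU₀, h'⟩ := h R hR2
  refine ⟨c₃, hc₃, U₀, hU₀, ?_⟩
  intro m P c hP hc hc6 hc₃' μ hμ U hU hU9 hU₀' β hβmin hβc K hK L M _ _ hL3 hM3 d k k' hd hk hkN Ωe
  have hβ : 0 < β := KLRegimeSplit.pos_of_klBetaMin_le hβmin
  exact h' m P c hP hc hc6 hc₃' μ hμ U hU hU9 hU₀' β hβmin hβc K hK L M hL3 hM3 (d * k') (d * k - 1) (block_jump_le hd hk) hkN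
    (klTowerIncr L M β U μ K d k') (fun m' X hX => klTowerIncr_momentumConserving β U μ K d k' m' X hX) Ωe
    (klTowerBornLev L M β U μ K d k' (m + 1) (levelCount Ωe)) (klTowerBornLev_nonneg hβ.le U μ K d k' (m + 1) _)
    (fun Ωe' hlev => by rw [← hlev]; exact klLevNormOf_le_klTowerBornLev β U μ K d k' (m + 1) Ωe')

omit [NeZero L] [NeZero M] in
/-- **THE SCALE-`0` ACTION `𝒱_0[K]` RE-MEASURED AT `F_{dk−1}`, m-UNIFORM** (twin of `klLevNormOf_scaleZero_remeasure_le_klEng`).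
[cite: BenfattoGiulianiMastropietro2006, §2.8 (2.82)-(2.84)] -/
theorem klLevNormOf_scaleZero_remeasure_le_klEng_uniform :
    ∃ C₁ C₂ : ℝ, 0 < C₁ ∧ 0 < C₂ ∧ ∀ R : RenConsts, R.WF2 → ∃ c₃' : ℝ, 0 < c₃' ∧ ∃ U₀' : ℝ, 0 < U₀' ∧ ∀ m : ℕ,
      ∀ (P : SplitConsts) (c : ℝ), P.WF → 0 < c → c ≤ klEngC₃6 P R → c ≤ c₃' →
      ∀ μ ∈ klWindowC, ∀ U : ℝ, 0 < U → U ≤ klEngU₀9 P R c → U ≤ U₀' → ∀ β : ℝ, klBetaMin ≤ β → β ≤ Real.exp (c / U ^ 2) →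
      ∀ K : TrigPolyC4v, FrameOK R U (nScales β) μ K → ∀ (L M : ℕ) [NeZero L] [NeZero M],
      klEngL₃ β U ≤ L → klEngM₃ β U L ≤ M → ∀ J' : ℕ, 1 ≤ J' → J' ≤ nScales β + 1 →
      ∀ (Ωe : Fin (m + 1) → Option (SectorLeg (sectorCount J'))) (N₀ : ℝ), 0 ≤ N₀ →
        (∀ Ωe' : Fin (m + 1) → Option (SectorLeg (sectorCount 0)), levelCount Ωe' = levelCount Ωe →
          klAnisoLegKernelNormAt L M β U μ K klE0 0 (m + 1) Ωe' ≤ N₀) →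
        klLevNormOf L M β μ K J' (m + 1) (klEffectiveAction L M β U μ K klE0 0) Ωe ≤ C₁ * C₂ ^ m * ((2 : ℝ) ^ J') ^ (m - levelCount Ωe) * N₀ := by
  obtain ⟨C₁, C₂, hC₁, hC₂, h⟩ := klLevNormOf_jump_le_klEng_uniform
  refine ⟨C₁, C₂, hC₁, hC₂, fun R hR2 => ?_⟩
  obtain ⟨c₃, hc₃, U₀, hU₀, h'⟩ := h R hR2
  refine ⟨c₃, hc₃, U₀, hU₀, ?_⟩
  intro m P c hP hc hc6 hc₃' μ hμ U hU hU9 hU₀' β hβmin hβc K hK L M _ _ hL3 hM3 J' hJ1 hJN Ωe N₀ hN0 hN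
  have hmain := h' m P c hP hc hc6 hc₃' μ hμ U hU hU9 hU₀' β hβmin hβc K hK L M hL3 hM3 0 J' (by omega) hJN
    (klEffectiveAction L M β U μ K klE0 0) (klEffectiveAction_momentumConserving β U μ K klE0 0) Ωe N₀ hN0
    (fun Ωe' hlev => by rw [klLevNormOf_klEffectiveAction]; exact hN Ωe' hlev)
  simpa only [Nat.sub_zero] using hmain

/-! ## §3 The summed levelled `hμ` row in absolute units, ONE m-uniform constant -/

omit [NeZero L] [NeZero M] in
/-- **THE LEVELLED `hμ` ROW IN ABSOLUTE UNITS, m-UNIFORM** (twin of `klTowerMeasLev_le_uv_add_sum_bornLev_klEng_lastLeg`): `C₁, C₂` and the thresholds fixed before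
the degree; for every `m`, `d ≥ 2`, `k ≥ 1`, `dk − 1 ≤ nScales β + 1`, level count `F` and level-0 bound `N₀`,
`klTowerMeasLev … d k (m+1) F ≤ C₁C₂^m·(2^{dk−1})^{m−F}·N₀ + Σ_{k′<k} C₁C₂^m·(2^{dk−1−dk′})^{m−F}·klTowerBornLev … d k′ (m+1) F`.
[cite: BenfattoGiulianiMastropietro2006, §2.8 (2.76), (2.82)-(2.84), (2.93)-(2.98)] -/
theorem klTowerMeasLev_le_uv_add_sum_bornLev_klEng_lastLeg_uniform :
    ∃ C₁ C₂ : ℝ, 0 < C₁ ∧ 0 < C₂ ∧ ∀ R : RenConsts, R.WF2 → ∃ c₃' : ℝ, 0 < c₃' ∧ ∃ U₀' : ℝ, 0 < U₀' ∧ ∀ m : ℕ,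
      ∀ (P : SplitConsts) (c : ℝ), P.WF → 0 < c → c ≤ klEngC₃6 P R → c ≤ c₃' →
      ∀ μ ∈ klWindowC, ∀ U : ℝ, 0 < U → U ≤ klEngU₀9 P R c → U ≤ U₀' → ∀ β : ℝ, klBetaMin ≤ β → β ≤ Real.exp (c / U ^ 2) →
      ∀ K : TrigPolyC4v, FrameOK R U (nScales β) μ K → ∀ (L M : ℕ) [NeZero L] [NeZero M],
      klEngL₃ β U ≤ L → klEngM₃ β U L ≤ M → ∀ d k : ℕ, 2 ≤ d → 1 ≤ k → d * k - 1 ≤ nScales β + 1 →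
      ∀ F : ℕ, ∀ N₀ : ℝ, 0 ≤ N₀ →
        (∀ Ωe' : Fin (m + 1) → Option (SectorLeg (sectorCount 0)), levelCount Ωe' = F →
          klAnisoLegKernelNormAt L M β U μ K klE0 0 (m + 1) Ωe' ≤ N₀) →
        klTowerMeasLev L M β U μ K d k (m + 1) F ≤
          C₁ * C₂ ^ m * ((2 : ℝ) ^ (d * k - 1)) ^ (m - F) * N₀ +
            ∑ k' ∈ range k, C₁ * C₂ ^ m * ((2 : ℝ) ^ (d * k - 1 - d * k')) ^ (m - F) * klTowerBornLev L M β U μ K d k' (m + 1) F := by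
  obtain ⟨C₁, C₂, hC₁, hC₂, huv⟩ := klLevNormOf_scaleZero_remeasure_le_klEng_uniform
  obtain ⟨C₁', C₂', hC₁', hC₂', hrel⟩ := klLevNormOf_klTowerIncr_remeasure_le_klEng_uniform
  refine ⟨max C₁ C₁', max C₂ C₂', by positivity, by positivity, fun R hR2 => ?_⟩
  obtain ⟨c₁', hc₁', U₁', hU₁', huv'⟩ := huv R hR2
  obtain ⟨c₃', hc₃', U₃', hU₃', hrel'⟩ := hrel R hR2
  refine ⟨min c₁' c₃', by positivity, min U₁' U₃', by positivity, ?_⟩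
  intro m P c hP hc hc6 hcmin μ hμ U hU hU9 hUmin β hβmin hβc K hK L M _ _ hL3 hM3 d k hd hk1 hkN F N₀ hN0 hN
  have hβ : 0 < β := KLRegimeSplit.pos_of_klBetaMin_le hβmin
  obtain ⟨hc₁, hc₃⟩ : c ≤ c₁' ∧ c ≤ c₃' := le_min_iff.1 hcmin
  obtain ⟨hU₁, hU₃⟩ : U ≤ U₁' ∧ U ≤ U₃' := le_min_iff.1 hUmin
  have hJ1 : 1 ≤ d * k - 1 := by have : 2 * 1 ≤ d * k := Nat.mul_le_mul hd hk1; omega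
  have hmax : C₁ * C₂ ^ m ≤ max C₁ C₁' * (max C₂ C₂') ^ m :=
    mul_le_mul (le_max_left _ _) (pow_le_pow_left₀ hC₂.le (le_max_left _ _) m) (by positivity) (by positivity)
  have hmax' : C₁' * C₂' ^ m ≤ max C₁ C₁' * (max C₂ C₂') ^ m :=
    mul_le_mul (le_max_right _ _) (pow_le_pow_left₀ hC₂'.le (le_max_right _ _) m) (by positivity) (by positivity)
  refine klTowerMeasLev_le_of_summand_bounds (L := L) (M := M) hβ.le U μ K d k (m + 1) F
    (W := fun k' => max C₁ C₁' * (max C₂ C₂') ^ m * ((2 : ℝ) ^ (d * k - 1 - d * k')) ^ (m - F) * klTowerBornLev L M β U μ K d k' (m + 1) F)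
    (by positivity) (fun k' _ => mul_nonneg (by positivity) (klTowerBornLev_nonneg hβ.le U μ K d k' (m + 1) F)) ?_ ?_
  · intro Ωe hlev
    have h := huv' m P c hP hc hc6 hc₁ μ hμ U hU hU9 hU₁ β hβmin hβc K hK L M hL3 hM3 (d * k - 1) hJ1 hkN Ωe N₀ hN0
      (fun Ωe' hlev' => hN Ωe' (hlev'.trans hlev))
    rw [hlev] at h
    exact h.trans (mul_le_mul_of_nonneg_right (mul_le_mul_of_nonneg_right hmax (by positivity)) hN0)
  · intro k' hk' Ωe hlev
    have h := hrel' m P c hP hc hc6 hc₃ μ hμ U hU hU9 hU₃ β hβmin hβc K hK L M hL3 hM3 d k k' hd hk' hkN Ωe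
    rw [hlev] at h
    exact h.trans (mul_le_mul_of_nonneg_right (mul_le_mul_of_nonneg_right hmax' (by positivity))
      (klTowerBornLev_nonneg hβ.le U μ K d k' (m + 1) F))

end Summit.HubbardSuperconductivity.HubbardSuperconductivity.Theorems.EngineV8

end
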